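import Literature.NumberTheory.EllipticCurves.Rank1Residual.Typed.X2RankZeroCertificate
import Literature.NumberTheory.EllipticCurves.Wuthrich2014.ShaBoundProofs
import Literature.NumberTheory.EllipticCurves.ComplexMultiplicationLFunctionIsogenyHoldsProofs
import Literature.NumberTheory.EllipticCurves.AnalyticRankOrderProofs
import HarnessLib

/-!
# The rank-`0` Cassels certificate READ ON AN ISOGENOUS CURVE — class-free and class-X2 forms
# (cell `bsd-litref`, seat `bsd-litref-cgs25-pv`; companion of `Typed/CasselsLowerBound.lean`)

HONEST FRAMING (programme `BSD-LIT2PART-PROGRAMME-v1.md` §T2d): nothing here proves BSD; theorems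
only (no definition, no new named fact, no `sorry`); per curve, never a class theorem.

`Typed/CasselsLowerBound.lean` (x11b) gives `BSD(E,p)` at a rank-`0` pair with odd non-additive `p`,
surjective-or-Borel image and `ord_p #Ш_an ≤ 2` from Wuthrich 2014 Prop. 21, Cassels–Tate squareness
and ONE finite certificate `p ∣ #Ш(E/ℚ)`; `Typed/X2RankZeroCertificate.lean` is its X2 instance and
`Rank1Residual/X1RankZeroCertificate.lean` (x1b) its X1 instance INCLUDING the ISOGENOUS form (the
certificate read on a `ℚ`-isogenous curve `W'`, `BSDp` transported by Cassels' isogeny invariance of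
the BSD quotient, `Wuthrich2014.bsdp_of_isIsogenous`). This file supplies the isogenous form for the
CLASS-FREE statement and for class X2 — the shape a two-engine `p`-isogeny descent delivers when the
member carrying `#Ш_an = p²` and `Ш[φ] ≠ 0` is not the census record (e.g. row D4's `298186d1 ← d2`,
`383344m1 ← m2`, which use the row-D4 door `RowC6.isogenous_bsdp_rankZero_of_casselsTate_of_shaTorsion`
of `Partition/MainConjecturesEisensteinDescentCertificate.lean`).

References: [Wuthrich2014] Prop. 21 (p. 400); [SilvermanAEC2009] Thm. X.4.14; [MilneADT2006] Thm. I.7.3,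
Rem. I.7.4; [Miller2011LMS] §1, Def. 1.1; [Knapp1993] Thm. 11.67 (isogenous curves share `L(E,s)`).
-/

noncomputable section

open scoped Classical

open WeierstrassCurve Literature.NumberTheory.EllipticCurves
  Literature.NumberTheory.EllipticCurves.Rank1Residual
  Literature.NumberTheory.EllipticCurves.Wuthrich2014

namespace Literature.NumberTheory.EllipticCurves.Rank1Residual.Typed

/-- **Class-free rank-`0` Cassels certificate on an ISOGENOUS curve.** `W ∼ W'` over `ℚ` (both
globally minimal elliptic), `ord_{s=1}L(W,s) = 0`; ON `W'`: `p` odd, not additive, surjective-or-Borel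
mod-`p` image, `#Ш_an(W') = q'` with `ord_p q' ≤ 2`, and a non-zero element of `Ш(W'/ℚ)` killed by
`p`. Then `BSDp W p`: `r_an(W') = 0` (`analyticRank_eq_of_isIsogenous'`, Knapp 11.67), `BSD(W',p)` by
`bsdp_of_wuthrich_of_casselsTate_of_dvd` + `dvd_shaOrder_of_exists_torsion`, transport by
`Wuthrich2014.bsdp_of_isIsogenous` (`hCassels`; `Ш(W')` finite by GZK, leading coefficient
`L(W',1) ≠ 0` by modularity). [cite: Wuthrich2014, Prop. 21 (p. 400)] [cite: SilvermanAEC2009, Thm. X.4.14]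
[cite: MilneADT2006, Thm. I.7.3 and Remark I.7.4] [cite: Miller2011LMS, §1 and Def. 1.1] -/
theorem bsdp_of_wuthrich_of_casselsTate_of_shaTorsion_of_isIsogenous
    (hCassels : bsdRHS_eq_of_isIsogenous) (hCT : exists_casselsTate_pairing (K := ℚ))
    (hW : sha_dvd_analyticSha) (hGZK : rank_eq_analyticRank_of_analyticRank_le_one)
    (hmod : hasEntireLFunction_rat)
    (W W' : WeierstrassCurve ℚ) [W.IsElliptic] [W'.IsElliptic] [W.IsGloballyMinimal]
    [W'.IsGloballyMinimal] (hiso : IsIsogenous W W') (p : ℕ) [Fact p.Prime] (hp : p ≠ 2)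
    (hr0 : W.analyticRank = 0)
    (hadd' : ¬ ((W'.baseChange ℚ_[p]).minimal ℤ_[p]).HasAdditiveReduction ℤ_[p])
    (himg' : ¬ W'.HasIrreducibleModPGaloisRep p ∨ W'.HasSurjectiveModNGaloisRep p)
    {q' : ℚ} (hq' : shaAn W' = (q' : ℂ)) (hv' : padicValRat p q' ≤ 2)
    (hx' : ∃ x : W'.sha, x ≠ 0 ∧ p • x = 0) : BSDp W p := by
  have hr0' : W'.analyticRank = 0 := by rw [← analyticRank_eq_of_isIsogenous' hiso]; exact hr0
  have h' : BSDp W' p :=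
    bsdp_of_wuthrich_of_casselsTate_of_dvd W' p hCT hW hGZK hmod hp hr0' hadd' himg' hq' hv'
      (dvd_shaOrder_of_exists_torsion W' p hx')
  exact Wuthrich2014.bsdp_of_isIsogenous hCassels hiso (hGZK W' (by omega)).2
    (W'.leadingLCoeff_ne_zero_holds (hmod W')) h'

/-- **Class X2 (multiplicative Eisenstein) ∧ `r_an = 0`, certificate on an ISOGENOUS member:**
`W ∼ W'`, `ord_{s=1}L(W,s) = 0`; ON `W'`: `ClassX2 W' p` (`p` odd, `W'[p]` reducible, multiplicative
at `p` — hence not additive and Borel), `#Ш_an(W') = q'` with `ord_p q' ≤ 2`, and a non-zero element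
of `Ш(W'/ℚ)` killed by `p` ⇒ `BSDp W p` (`X2.bsdp_of_casselsTate_of_exists_torsion` on `W'`, then
Cassels transport). [cite: Wuthrich2014, Prop. 21 (p. 400)] [cite: SilvermanAEC2009, Thm. X.4.14]
[cite: MilneADT2006, Thm. I.7.3 and Remark I.7.4] [cite: Miller2011LMS, §1 and Def. 1.1] -/
theorem X2.bsdp_of_casselsTate_of_exists_torsion_of_isIsogenous
    (hCassels : bsdRHS_eq_of_isIsogenous) (hCT : exists_casselsTate_pairing (K := ℚ))
    (hW : sha_dvd_analyticSha) (hGZK : rank_eq_analyticRank_of_analyticRank_le_one)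
    (hmod : hasEntireLFunction_rat)
    (W W' : WeierstrassCurve ℚ) [W.IsElliptic] [W'.IsElliptic] [W.IsGloballyMinimal]
    [W'.IsGloballyMinimal] (hiso : IsIsogenous W W') (p : ℕ) [Fact p.Prime]
    (hr0 : W.analyticRank = 0) (hX' : ClassX2 W' p)
    {q' : ℚ} (hq' : shaAn W' = (q' : ℂ)) (hv' : padicValRat p q' ≤ 2)
    (hx' : ∃ x : W'.sha, x ≠ 0 ∧ p • x = 0) : BSDp W p := by
  have hr0' : W'.analyticRank = 0 := by rw [← analyticRank_eq_of_isIsogenous' hiso]; exact hr0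
  have h' : BSDp W' p :=
    X2.bsdp_of_casselsTate_of_exists_torsion W' p hCT hW hGZK hmod hr0' hX' hq' hv' hx'
  exact Wuthrich2014.bsdp_of_isIsogenous hCassels hiso (hGZK W' (by omega)).2
    (W'.leadingLCoeff_ne_zero_holds (hmod W')) h'

end Literature.NumberTheory.EllipticCurves.Rank1Residual.Typed

end
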